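import Summits.Parity.GeneralizedHardyLittlewood.Theorems.PrimeLevelFamEdgeMomentsBeyondDiagonalDiagDecorOrderZeroFourHecke
import Summits.Parity.GeneralizedHardyLittlewood.Theorems.PrimeLevelFamEdgeMomentsBeyondDiagonalDiagDecorOrderTwoTwoAssembly
import HarnessLib

/-!
# Route `PrimeLevelFamEdge`, crux K_A `MomentsBeyondDiagonal` (stmt-Parity-20007), line «petersson_layers» v4, stub `stub_diag`:
# **THE ORDER-`(0,4)` TARGET (first order of rung `N = 4`) FROM ITS TWO ANALYTIC INPUTS: the polynomial asymptotic (Poly₀₄)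
# and the remainder estimate (R₀₄)** — the order-`(0,4)` twin of `…DiagDecorOrderOneThreeAssembly` (p831622)

With the exact identities of `…DiagDecorOrderZeroFourHecke` (`selbergOrderZeroFour_hecke_eq`, `selbergOrderZeroFour_split`) the
order-`(0,4)` target of `…DiagOrderSymm.subDiag_of_selbergOrderAsymptotics_of_le` (`i = 0`, `j = 4`; normalisation
`|Sel₀₄(q) − K₀·log²q̂| ≤ C·log q̂`, `…DiagDecorOrderTargetNormalize.orderTarget_of_selbergAsymptotic`) follows from

  (Poly₀₄) `∀ P (P₀ = P₁ = 0), ∀ λ ∈ [0,1], ∀ E.. μ₂ μ₄, ∃ C, ∀ M ≥ 3: |Sel(poly₀₄)(M) − 𝔎(λ,P)·log²M| ≤ C·log M`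
     for SOME level-free functional `𝔎` (the sixteen monomials of the split — ALL covered by landed engines, so (Poly₀₄) is proved
     unconditionally in `…DiagDecorOrderZeroFourPoly` with `𝔎 = (π²/6)²(Φ₅/160 + Ψ₃/8 + (3/16)Ξ₁)`), and
  (R₀₄)    `∃ E₀₀ … E₁₃ μ₂ μ₄, ∀ P admissible, ∀ Δ′ ∈ (1,Δ], ∃ C q₀, ∀ q ≥ q₀: |Sel(rem₀₄)(q)| ≤ C·log q̂`
     (`rem₀₄` = the order-`(0,4)` weight with every Bose coefficient `c_ab(y)` replaced by `c_ab(y) − Π_ab(log(1/y))`,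
     `|c_ab − Π_ab| ≪ y(1+log(1/y))^{a+b+1}` by `…DiagBoseMixedStructure.bose_coeff_structure`; the famedge-1 remainder machinery).

* `orderZeroFour_target_of_poly_of_remainder` — **(Poly₀₄) ⟹ (R₀₄) ⟹ the order-`(0,4)` target** with
  `τ₀₄(Δ′,P) = Δ′²K₀/(2(π²/6)²)`, `K₀ = Δ′²·𝔎(1/Δ′,P)`.

Def-free; theorems only. Helper `--supports stmt-Parity-20007`; closes nothing; K_A, K_B and the Parity summit are NOT proved;
nothing about Landau–Siegel zeros.

## References
* E. Kowalski, P. Michel, J. VanderKam, J. reine angew. Math. 526 (2000), (23)–(28) pp. 13–15 and Prop. 5.1 p. 18.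
  [cite: KowalskiMichelVanderKam2000, (23)–(28) — derivation (order-(0,4) piece of the diagonal main term, general Q)]
-/

noncomputable section

open scoped Real ArithmeticFunction.Moebius
open Finset ArithmeticFunction Polynomial MeasureTheory Set

namespace Summit.Parity.GeneralizedHardyLittlewood.Theorems.MomentsBeyondDiagonal.DiagKernel

open Literature.NumberTheory.LFunctions Literature.NumberTheory.LFunctions.KMV2000

set_option maxHeartbeats 800000 in
-- large statement, linear bookkeeping
/-- **(Poly₀₄) ⟹ (R₀₄) ⟹ the order-`(0,4)` target** (window `(1,Δ]`, any `Δ`; see the module docstring).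
[cite: KowalskiMichelVanderKam2000, (23)–(28) and Prop. 5.1 — derivation] -/
theorem orderZeroFour_target_of_poly_of_remainder {Δ : ℝ} (𝔎 : ℝ → ℝ[X] → ℝ)
    (hPoly : ∀ P : ℝ[X], P.coeff 0 = 0 → P.coeff 1 = 0 → ∀ lam : ℝ, 0 ≤ lam → lam ≤ 1 →
      ∀ E₀₀ E₀₁ E₀₂ E₀₃ E₀₄ μ₂ μ₄ : ℝ, ∃ C : ℝ, ∀ M : ℝ, 3 ≤ M →
      |∑ c ∈ Icc 1 ⌊M⌋₊, ∑ g ∈ Icc 1 (⌊M⌋₊ / c), (μ g : ℝ) * c *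
        ∑ k₁ ∈ Icc 1 (⌊M⌋₊ / (c * g)), ∑ k₂ ∈ Icc 1 (⌊M⌋₊ / (c * g)),
          ((μ (c * g * k₁) : ℝ) * ((psi (c * g * k₁))⁻¹ *
              P.eval (Real.log (M / ((c * g * k₁ : ℕ) : ℝ)) / Real.log M)) / ((c * g * k₁ : ℕ) : ℝ)) *
            ((μ (c * g * k₂) : ℝ) * ((psi (c * g * k₂))⁻¹ *
              P.eval (Real.log (M / ((c * g * k₂ : ℕ) : ℝ)) / Real.log M)) / ((c * g * k₂ : ℕ) : ℝ)) *
            ((1 / 160) * ((k₁.divisors.card : ℝ) * (k₂.divisors.card : ℝ) *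
                (2 * (lam * Real.log M) - 2 * Real.log g - Real.log k₁ - Real.log k₂) ^ 5) +
              (E₀₀ / 16) * ((k₁.divisors.card : ℝ) * (k₂.divisors.card : ℝ) *
                (2 * (lam * Real.log M) - 2 * Real.log g - Real.log k₁ - Real.log k₂) ^ 4) +
              (E₀₁ / 2 + μ₂) * ((k₁.divisors.card : ℝ) * (k₂.divisors.card : ℝ) *
                (2 * (lam * Real.log M) - 2 * Real.log g - Real.log k₁ - Real.log k₂) ^ 3) +
              (3 * E₀₂ / 2) * ((k₁.divisors.card : ℝ) * (k₂.divisors.card : ℝ) *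
                (2 * (lam * Real.log M) - 2 * Real.log g - Real.log k₁ - Real.log k₂) ^ 2) +
              (2 * E₀₃ + 2 * μ₄) * ((k₁.divisors.card : ℝ) * (k₂.divisors.card : ℝ) *
                (2 * (lam * Real.log M) - 2 * Real.log g - Real.log k₁ - Real.log k₂) ^ 1) +
              E₀₄ * ((k₁.divisors.card : ℝ) * (k₂.divisors.card : ℝ) *
                (2 * (lam * Real.log M) - 2 * Real.log g - Real.log k₁ - Real.log k₂) ^ 0) +
              (1 / 16) * ((k₁.divisors.card : ℝ) * (∑ p ∈ k₁.primeFactors, Real.log p ^ 2) * (k₂.divisors.card : ℝ) *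
                (2 * (lam * Real.log M) - 2 * Real.log g - Real.log k₁ - Real.log k₂) ^ 3) +
              (3 * E₀₀ / 8) * ((k₁.divisors.card : ℝ) * (∑ p ∈ k₁.primeFactors, Real.log p ^ 2) * (k₂.divisors.card : ℝ) *
                (2 * (lam * Real.log M) - 2 * Real.log g - Real.log k₁ - Real.log k₂) ^ 2) +
              (3 * E₀₁ / 2 + 3 * μ₂) * ((k₁.divisors.card : ℝ) * (∑ p ∈ k₁.primeFactors, Real.log p ^ 2) * (k₂.divisors.card : ℝ) *
                (2 * (lam * Real.log M) - 2 * Real.log g - Real.log k₁ - Real.log k₂) ^ 1) +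
              (3 * E₀₂ / 2) * ((k₁.divisors.card : ℝ) * (∑ p ∈ k₁.primeFactors, Real.log p ^ 2) * (k₂.divisors.card : ℝ) *
                (2 * (lam * Real.log M) - 2 * Real.log g - Real.log k₁ - Real.log k₂) ^ 0) +
              (1 / 16) * ((k₁.divisors.card : ℝ) * ((k₂.divisors.card : ℝ) * ∑ p ∈ k₂.primeFactors, Real.log p ^ 2) *
                (2 * (lam * Real.log M) - 2 * Real.log g - Real.log k₁ - Real.log k₂) ^ 3) +
              (3 * E₀₀ / 8) * ((k₁.divisors.card : ℝ) * ((k₂.divisors.card : ℝ) * ∑ p ∈ k₂.primeFactors, Real.log p ^ 2) *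
                (2 * (lam * Real.log M) - 2 * Real.log g - Real.log k₁ - Real.log k₂) ^ 2) +
              (3 * E₀₁ / 2 + 3 * μ₂) * ((k₁.divisors.card : ℝ) * ((k₂.divisors.card : ℝ) * ∑ p ∈ k₂.primeFactors, Real.log p ^ 2) *
                (2 * (lam * Real.log M) - 2 * Real.log g - Real.log k₁ - Real.log k₂) ^ 1) +
              (3 * E₀₂ / 2) * ((k₁.divisors.card : ℝ) * ((k₂.divisors.card : ℝ) * ∑ p ∈ k₂.primeFactors, Real.log p ^ 2) *
                (2 * (lam * Real.log M) - 2 * Real.log g - Real.log k₁ - Real.log k₂) ^ 0) +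
              (3 / 16) * ((k₁.divisors.card : ℝ) * (∑ p ∈ k₁.primeFactors, Real.log p ^ 2) *
                ((k₂.divisors.card : ℝ) * (∑ p ∈ k₂.primeFactors, Real.log p ^ 2)) *
                (2 * (lam * Real.log M) - 2 * Real.log g - Real.log k₁ - Real.log k₂) ^ 1) +
              (3 * E₀₀ / 8) * ((k₁.divisors.card : ℝ) * (∑ p ∈ k₁.primeFactors, Real.log p ^ 2) *
                ((k₂.divisors.card : ℝ) * (∑ p ∈ k₂.primeFactors, Real.log p ^ 2)) *
                (2 * (lam * Real.log M) - 2 * Real.log g - Real.log k₁ - Real.log k₂) ^ 0) +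
              (1 / 32) * ((k₁.divisors.card : ℝ) * (3 * (∑ p ∈ k₁.primeFactors, Real.log p ^ 2) ^ 2 - 2 * ∑ p ∈ k₁.primeFactors, Real.log p ^ 4) *
                (k₂.divisors.card : ℝ) * (2 * (lam * Real.log M) - 2 * Real.log g - Real.log k₁ - Real.log k₂) ^ 1) +
              (E₀₀ / 16) * ((k₁.divisors.card : ℝ) * (3 * (∑ p ∈ k₁.primeFactors, Real.log p ^ 2) ^ 2 - 2 * ∑ p ∈ k₁.primeFactors, Real.log p ^ 4) *
                (k₂.divisors.card : ℝ) * (2 * (lam * Real.log M) - 2 * Real.log g - Real.log k₁ - Real.log k₂) ^ 0) +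
              (1 / 32) * ((k₁.divisors.card : ℝ) * ((k₂.divisors.card : ℝ) *
                (3 * (∑ p ∈ k₂.primeFactors, Real.log p ^ 2) ^ 2 - 2 * ∑ p ∈ k₂.primeFactors, Real.log p ^ 4)) *
                (2 * (lam * Real.log M) - 2 * Real.log g - Real.log k₁ - Real.log k₂) ^ 1) +
              (E₀₀ / 16) * ((k₁.divisors.card : ℝ) * ((k₂.divisors.card : ℝ) *
                (3 * (∑ p ∈ k₂.primeFactors, Real.log p ^ 2) ^ 2 - 2 * ∑ p ∈ k₂.primeFactors, Real.log p ^ 4)) *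
                (2 * (lam * Real.log M) - 2 * Real.log g - Real.log k₁ - Real.log k₂) ^ 0)) -
        𝔎 lam P * Real.log M ^ 2| ≤ C * Real.log M)
    (hR : ∃ E₀₀ E₀₁ E₀₂ E₀₃ E₀₄ μ₂ μ₄ : ℝ, ∀ P : ℝ[X], KMV2000.Admissible P → ∀ Δ' : ℝ, 1 < Δ' → Δ' ≤ Δ →
      ∃ C : ℝ, ∃ q₀ : ℕ, ∀ (q : ℕ) [NeZero q], q₀ ≤ q →
        |∑ c ∈ Icc 1 ⌊qhat q ^ Δ'⌋₊, ∑ g ∈ Icc 1 (⌊qhat q ^ Δ'⌋₊ / c), (μ g : ℝ) * c *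
        ∑ k₁ ∈ Icc 1 (⌊qhat q ^ Δ'⌋₊ / (c * g)), ∑ k₂ ∈ Icc 1 (⌊qhat q ^ Δ'⌋₊ / (c * g)),
          ((μ (c * g * k₁) : ℝ) * ((psi (c * g * k₁))⁻¹ *
              P.eval (Real.log (qhat q ^ Δ' / ((c * g * k₁ : ℕ) : ℝ)) / Real.log (qhat q ^ Δ'))) / ((c * g * k₁ : ℕ) : ℝ)) *
            ((μ (c * g * k₂) : ℝ) * ((psi (c * g * k₂))⁻¹ *
              P.eval (Real.log (qhat q ^ Δ' / ((c * g * k₂ : ℕ) : ℝ)) / Real.log (qhat q ^ Δ'))) / ((c * g * k₂ : ℕ) : ℝ)) *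
            ((k₁.divisors.card : ℝ) * (k₂.divisors.card : ℝ) *
          (((2 * (Real.log (qhat q) - Real.log g) - Real.log k₁ - Real.log k₂) ^ 4 +
                6 * (2 * (Real.log (qhat q) - Real.log g) - Real.log k₁ - Real.log k₂) ^ 2 * ((∑ p ∈ k₁.primeFactors, Real.log p ^ 2) + ∑ p ∈ k₂.primeFactors, Real.log p ^ 2) +
                3 * ((∑ p ∈ k₁.primeFactors, Real.log p ^ 2) + ∑ p ∈ k₂.primeFactors, Real.log p ^ 2) ^ 2 -
                2 * ((∑ p ∈ k₁.primeFactors, Real.log p ^ 4) + ∑ p ∈ k₂.primeFactors, Real.log p ^ 4)) / 16 *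
              ((∫ u₁ in Ioi (0 : ℝ), ∫ u₂ in Ioi ((((g * g * (k₁ * k₂) : ℕ) : ℝ) / qhat q ^ 2) / u₁),
              Real.exp (-(u₁ + u₂)) / (1 - Real.exp (-(u₁ + u₂))) ^ 2) -
                  (Real.log (qhat q ^ 2 / ((g * g * (k₁ * k₂) : ℕ) : ℝ)) / 2 + E₀₀)) +
            ((2 * (Real.log (qhat q) - Real.log g) - Real.log k₁ - Real.log k₂) ^ 3 +
                3 * (2 * (Real.log (qhat q) - Real.log g) - Real.log k₁ - Real.log k₂) * ((∑ p ∈ k₁.primeFactors, Real.log p ^ 2) + ∑ p ∈ k₂.primeFactors, Real.log p ^ 2)) / 2 *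
              ((∫ u₁ in Ioi (0 : ℝ), ∫ u₂ in Ioi ((((g * g * (k₁ * k₂) : ℕ) : ℝ) / qhat q ^ 2) / u₁),
              Real.exp (-(u₁ + u₂)) / (1 - Real.exp (-(u₁ + u₂))) ^ 2 * Real.log u₂) -
                  (-(Real.log (qhat q ^ 2 / ((g * g * (k₁ * k₂) : ℕ) : ℝ)) ^ 2) / 8 + E₀₁)) +
            (3 * (2 * (Real.log (qhat q) - Real.log g) - Real.log k₁ - Real.log k₂) ^ 2 +
                3 * ((∑ p ∈ k₁.primeFactors, Real.log p ^ 2) + ∑ p ∈ k₂.primeFactors, Real.log p ^ 2)) / 2 *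
              ((∫ u₁ in Ioi (0 : ℝ), ∫ u₂ in Ioi ((((g * g * (k₁ * k₂) : ℕ) : ℝ) / qhat q ^ 2) / u₁),
              Real.exp (-(u₁ + u₂)) / (1 - Real.exp (-(u₁ + u₂))) ^ 2 * Real.log u₂ ^ 2) -
                  (Real.log (qhat q ^ 2 / ((g * g * (k₁ * k₂) : ℕ) : ℝ)) ^ 3 / 24 + 2 * μ₂ * Real.log (qhat q ^ 2 / ((g * g * (k₁ * k₂) : ℕ) : ℝ)) + E₀₂)) +
            2 * (2 * (Real.log (qhat q) - Real.log g) - Real.log k₁ - Real.log k₂) *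
              ((∫ u₁ in Ioi (0 : ℝ), ∫ u₂ in Ioi ((((g * g * (k₁ * k₂) : ℕ) : ℝ) / qhat q ^ 2) / u₁),
              Real.exp (-(u₁ + u₂)) / (1 - Real.exp (-(u₁ + u₂))) ^ 2 * Real.log u₂ ^ 3) -
                  (-(Real.log (qhat q ^ 2 / ((g * g * (k₁ * k₂) : ℕ) : ℝ)) ^ 4) / 64 - 3 * μ₂ / 2 * Real.log (qhat q ^ 2 / ((g * g * (k₁ * k₂) : ℕ) : ℝ)) ^ 2 + E₀₃)) +
            ((∫ u₁ in Ioi (0 : ℝ), ∫ u₂ in Ioi ((((g * g * (k₁ * k₂) : ℕ) : ℝ) / qhat q ^ 2) / u₁),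
              Real.exp (-(u₁ + u₂)) / (1 - Real.exp (-(u₁ + u₂))) ^ 2 * Real.log u₂ ^ 4) -
                  (Real.log (qhat q ^ 2 / ((g * g * (k₁ * k₂) : ℕ) : ℝ)) ^ 5 / 160 + μ₂ * Real.log (qhat q ^ 2 / ((g * g * (k₁ * k₂) : ℕ) : ℝ)) ^ 3 + 2 * μ₄ * Real.log (qhat q ^ 2 / ((g * g * (k₁ * k₂) : ℕ) : ℝ)) + E₀₄))))| ≤
          C * Real.log (qhat q)) :
    ∀ P : ℝ[X], KMV2000.Admissible P → ∀ Δ' : ℝ, 1 < Δ' → Δ' ≤ Δ →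
      ∃ C : ℝ, ∃ q₀ : ℕ, ∀ (q : ℕ) [NeZero q], q₀ ≤ q →
        |(Real.log (qhat q))⁻¹ ^ (0 + 4) * qhat q *
          (∑ c ∈ Icc 1 ⌊qhat q ^ Δ'⌋₊, ∑ g ∈ Icc 1 (⌊qhat q ^ Δ'⌋₊ / c), (μ g : ℝ) * c *
        ∑ k₁ ∈ Icc 1 (⌊qhat q ^ Δ'⌋₊ / (c * g)), ∑ k₂ ∈ Icc 1 (⌊qhat q ^ Δ'⌋₊ / (c * g)),
          ((μ (c * g * k₁) : ℝ) * ((psi (c * g * k₁))⁻¹ *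
              P.eval (Real.log (qhat q ^ Δ' / ((c * g * k₁ : ℕ) : ℝ)) / Real.log (qhat q ^ Δ'))) / ((c * g * k₁ : ℕ) : ℝ)) *
            ((μ (c * g * k₂) : ℝ) * ((psi (c * g * k₂))⁻¹ *
              P.eval (Real.log (qhat q ^ Δ' / ((c * g * k₂ : ℕ) : ℝ)) / Real.log (qhat q ^ Δ'))) / ((c * g * k₂ : ℕ) : ℝ)) *
            (∑ d ∈ k₁.divisors, ∑ e ∈ k₂.divisors,
              ∫ u₁ in Ioi (0 : ℝ),
                (Real.log (qhat q / ((k₁ / d * (g * e) : ℕ) : ℝ)) + Real.log u₁) ^ 0 *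
                ∫ u₂ in Ioi ((((k₁ / d * (g * e) * (g * d * (k₂ / e)) : ℕ) : ℝ) / qhat q ^ 2) / u₁),
                  Real.exp (-(u₁ + u₂)) / (1 - Real.exp (-(u₁ + u₂))) ^ 2 *
                  (Real.log (qhat q / ((g * d * (k₂ / e) : ℕ) : ℝ)) + Real.log u₂) ^ 4)) -
          2 * (π ^ 2 / 6) ^ 2 * (qhat q / (Δ' ^ 2 * Real.log (qhat q) ^ 2)) *
            (Δ' ^ 2 * (Δ' ^ 2 * 𝔎 (1 / Δ') P) / (2 * (π ^ 2 / 6) ^ 2))| ≤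
          C * qhat q * (Real.log (qhat q))⁻¹ ^ 3 := by
  obtain ⟨E₀₀, E₀₁, E₀₂, E₀₃, E₀₄, μ₂, μ₄, hR⟩ := hR
  intro P hP Δ' h1 h2
  obtain ⟨hP0, hP1⟩ := coeff_zero_one_of_admissible hP
  have hΔ0 : 0 < Δ' := by linarith
  have hlam0 : (0 : ℝ) ≤ 1 / Δ' := by positivity
  have hlam1 : 1 / Δ' ≤ 1 := (div_le_one hΔ0).2 h1.le
  obtain ⟨C_R, q_R, hRq⟩ := hR P hP Δ' h1 h2
  obtain ⟨C_P, hpoly⟩ := hPoly P hP0 hP1 (1 / Δ') hlam0 hlam1 E₀₀ E₀₁ E₀₂ E₀₃ E₀₄ μ₂ μ₄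
  obtain ⟨q₃, hq₃⟩ := exists_log_qhat_ge (2 : ℝ)
  refine orderTarget_of_selbergAsymptotic 0 4 _ _ hΔ0.ne' ⟨|C_P| * Δ' + C_R, max q_R q₃, fun q _ hq ↦ ?_⟩
  have hqR : q_R ≤ q := le_trans (le_max_left _ _) hq
  have hl2 : (2 : ℝ) ≤ Real.log (qhat q) := hq₃ q (le_trans (le_max_right _ _) hq)
  have hQ0 : 0 ≤ qhat q := by unfold qhat; positivity
  have hQ : 0 < qhat q := lt_of_le_of_ne hQ0 fun h0 ↦ by
    rw [← h0, Real.log_zero] at hl2; linarith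
  have hq3 : (3 : ℝ) ≤ qhat q := by
    have := Real.add_one_le_exp (Real.log (qhat q))
    rw [Real.exp_log hQ] at this
    linarith
  have hQ1 : 1 ≤ qhat q := by linarith
  have hM3 : 3 ≤ qhat q ^ Δ' := hq3.trans (Real.self_le_rpow_of_one_le hQ1 h1.le)
  have hlogM : Real.log (qhat q ^ Δ') = Δ' * Real.log (qhat q) := Real.log_rpow hQ Δ'
  have hℓpos : 0 < Real.log (qhat q) := Real.log_pos (by linarith)
  have hlam : Real.log (qhat q) = 1 / Δ' * Real.log (qhat q ^ Δ') := by rw [hlogM]; field_simp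
  -- exact Hecke form and split
  rw [selbergOrderZeroFour_hecke_eq P (qhat q ^ Δ') ⌊qhat q ^ Δ'⌋₊ hQ]
  have hsplit := selbergOrderZeroFour_split P (qhat q ^ Δ') hQ hlam
    (fun y ↦ ∫ u₁ in Ioi (0 : ℝ), ∫ u₂ in Ioi (y / u₁),
      Real.exp (-(u₁ + u₂)) / (1 - Real.exp (-(u₁ + u₂))) ^ 2)
    (fun y ↦ ∫ u₁ in Ioi (0 : ℝ), ∫ u₂ in Ioi (y / u₁),
      Real.exp (-(u₁ + u₂)) / (1 - Real.exp (-(u₁ + u₂))) ^ 2 * Real.log u₂)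
    (fun y ↦ ∫ u₁ in Ioi (0 : ℝ), ∫ u₂ in Ioi (y / u₁),
      Real.exp (-(u₁ + u₂)) / (1 - Real.exp (-(u₁ + u₂))) ^ 2 * Real.log u₂ ^ 2)
    (fun y ↦ ∫ u₁ in Ioi (0 : ℝ), ∫ u₂ in Ioi (y / u₁),
      Real.exp (-(u₁ + u₂)) / (1 - Real.exp (-(u₁ + u₂))) ^ 2 * Real.log u₂ ^ 3)
    (fun y ↦ ∫ u₁ in Ioi (0 : ℝ), ∫ u₂ in Ioi (y / u₁),
      Real.exp (-(u₁ + u₂)) / (1 - Real.exp (-(u₁ + u₂))) ^ 2 * Real.log u₂ ^ 4)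
    E₀₀ E₀₁ E₀₂ E₀₃ E₀₄ μ₂ μ₄
  beta_reduce at hsplit
  rw [hsplit]
  have hp := hpoly (qhat q ^ Δ') hM3
  have hr := hRq q hqR
  -- the polynomial error `C_P·log M = C_P·Δ'·log q̂ ≤ |C_P|·Δ'·log q̂`
  have hCP : C_P * Real.log (qhat q ^ Δ') ≤ |C_P| * Δ' * Real.log (qhat q) := by
    rw [hlogM]
    have : C_P * (Δ' * Real.log (qhat q)) ≤ |C_P| * (Δ' * Real.log (qhat q)) :=
      mul_le_mul_of_nonneg_right (le_abs_self _) (by positivity)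
    linarith
  have hp' := hp.trans hCP
  have key : ∀ {A B K₁ c₁ c₂ ℓ : ℝ}, |A - K₁| ≤ c₁ * ℓ → |B| ≤ c₂ * ℓ → |A + B - K₁| ≤ (c₁ + c₂) * ℓ := by
    intro A B K₁ c₁ c₂ ℓ hA hB
    calc |A + B - K₁| = |(A - K₁) + B| := by ring_nf
      _ ≤ |A - K₁| + |B| := abs_add_le _ _
      _ ≤ c₁ * ℓ + c₂ * ℓ := add_le_add hA hB
      _ = (c₁ + c₂) * ℓ := by ring
  have hfin := key hp' hr
  have e1 : Δ' ^ 2 * 𝔎 (1 / Δ') P * Real.log (qhat q) ^ (0 + 4) / Real.log (qhat q) ^ 2 =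
      𝔎 (1 / Δ') P * Real.log (qhat q ^ Δ') ^ 2 := by
    rw [hlogM, div_eq_iff (pow_ne_zero _ hℓpos.ne')]
    ring
  have e2 : (|C_P| * Δ' + C_R) * Real.log (qhat q) ^ (0 + 4) / Real.log (qhat q) ^ 3 =
      (|C_P| * Δ' + C_R) * Real.log (qhat q) := by
    rw [div_eq_iff (pow_ne_zero _ hℓpos.ne')]
    ring
  rw [e1, e2]
  exact hfin

end Summit.Parity.GeneralizedHardyLittlewood.Theorems.MomentsBeyondDiagonal.DiagKernel

end
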